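import Summits.BirchSwinnertonDyer.BirchSwinnertonDyer.Theorems.KimAtThreeTwoExponentPortOfZetaBodyU
import Summits.BirchSwinnertonDyer.BirchSwinnertonDyer.Theorems.KimAtThreeDeepLowerOffStratumAdditiveDefectTorsionSplit
import Summits.BirchSwinnertonDyer.BirchSwinnertonDyer.Theorems.KimAtThreeShallowEqDeepOffStratumAdditiveDefectOfZetaBody
import Summits.BirchSwinnertonDyer.BirchSwinnertonDyer.Theorems.KimAtThreeDeepUpperCertSupplyDefect
import HarnessLib

/-!
# Route `KimAtThreeKolyvagin` (rung W2), the `t = 0` ADDITIVE-DEFECT rows of cruxes 19599 / 19679 (and 19562):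
# PORT₂ and the registered stubs from the fine Kato package (C1₂) ALONE — (C2₂) a theorem (w2-c3), (C3₂) REMOVED
# (hbad-free ★₂′-u) — route W2, cell `bsd-addord`, seat `bsd-addord-w2-acc3` (PROGRAMME PART 1b row (3)), gen 3

HONEST FRAMING. TOOL theorems only (no definition, no named fact, no `sorry`); nothing asserted, nothing booked,
no mark moved; cruxes 19599 / 19679 / 19562 stay OPEN (their OWNERS assemble).  Third file of this seat's
(C3₂)-removal: ★★-u (`KimAtThreeTwoExponentWitnessPairU`, p477319) and ★₂-u/★₂′-u
(`KimAtThreeTwoExponentPortOfZetaBodyU`) re-key seat acc6 gen 2's two-exponent chain on seat w2-c3 gen 5's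
THEOREM D-u (no `hbad`); here the row/rows/stub layer of acc6's `KimAtThreeShallowEqDeepOffStratumAdditiveDefectOfZetaBody`
is re-run WITHOUT the anomalous case split:

* §1 `portTwoExp_row_of_fineKato_of_certSupply` — PORT₂ at ONE `t = 0` additive-defect row from (C1₂) + (C2₂),
  anomalous bad places allowed (acc6's `…_of_noAnomalous` with `hbad` deleted, via ★₂′-u).
* §2 `portTwoExp_rows_of_fineKato_of_certSupply : (C1₂) → (C2₂) → hPort₂⁰` — acc6 gen 0's / this seat's `t = 0`
  port binder (TOKEN FOR TOKEN the `hPort₂` of `…AdditiveDefectOfPort.stub_additiveDefect_of_portTwoExp` and of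
  `…TorsionSplit.stubAdditiveDefect_of_portTwoExp_torsionFree_of_torsionRows`) with NO (C3₂).
* §3 `portTwoExp_rows_of_fineKato : (C1₂) → hPort₂⁰` — (C2₂) discharged by w2-c3's theorem
  `KimAtThreeDeepUpperCertSupplyDefect.certSupply_defectRows`.
* §4 **`stub19679_additiveDefect_of_fineKato_of_torsionRows : hS24 → hS24₂ → hGZK → hPT → (C1₂) → (R₁) → ⟨19679 stub VERBATIM⟩`**
  and **`stub19599_additiveDefect_of_fineKato : hS24 → hS24₂ → hGZK → hPT → (C1₂) → ⟨19599 stub VERBATIM⟩`**.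

NET (for the owners / the planner's residual of record): on the `t = 0` additive-defect rows (Kodaira IV/IV*
`3 ∣ c₃`, `3 ∣ c_{D₀}`) of 19599 and 19679 the ONLY displayed object is the fine Kato package (C1₂) — SOME Kato
witnesses of the `ZetaBody` family admitting finite-level functionals with DICT3's (Λ)-clauses and the two-exponent
riders (ii₂) for ONE `e`, `κK` a rational `3`-unit (CONSTRUCTION-SHAPED; object = the dual exponential,
`defn-BlochKatoDualExponential`; = crux 19560's (C1) with rider clause (ii) ↦ (ii₂)) — exactly as 19560 rests on
(C1) alone after w2-c3's p471554; 19679 carries in addition the one displayed line (R₁) on its `t ≥ 1` rows.  For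
19562 the same `hPort₂⁰` feeds seat w2-c4's PORT road / seat acc1's consumers (not re-assembled here).
Credit: seat acc6 gen 0/2 (two-exponent chain, row/rows/stub layer), seat w2-c3 gen 5 (D-u, (C2₂)), seat kim3
(§1 lemmas), team n1011 (★ PK-6₂ and the value rows); this seat re-keys and splits by torsion.
References: [Kato2004Asterisque] (8.1.3), §8.2, Lemma 8.5, Prop. 8.12, §9.4, Thm. 9.7, Thm. 6.6 (1), Ex. 13.3;
[Kim2022StructureSelmer] §3.2.3, Thm. 3.6, Thm. 3.13, §3.3; [MazurRubin2004] Thm. 3.2.4, Thm. 5.2.12, App. A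
(Remark A.5); [Sakamoto2024] Thm. 4.4; [Kim2025RefinedTNC] Thm 1.1/1.2, §4.2, §8.1.2; [Rubin2000] Thm. 4.5.1;
[TateGCFT1967] §2.4.
-/

set_option autoImplicit false
-- the Theorems namespace of a single-conjunct summit repeats the summit name by design (D-0017)
set_option linter.dupNamespace false

noncomputable section

open scoped NumberField TensorProduct ContRepresentation Classical
open Field Finset IsDedekindDomain NumberField WeierstrassCurve Rat.HeightOneSpectrum
open Literature.NumberTheory.GaloisRepresentations Literature.NumberTheory.GaloisCohomology
open Literature.NumberTheory.GaloisRepresentations.DiscreteGaloisModule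
open Literature.NumberTheory.EllipticCurves Literature.NumberTheory.EllipticCurves.ModularForms
open Literature.NumberTheory.EllipticCurves.Rank1Residual
open Literature.NumberTheory.EllipticCurves.Kato2004
open Literature.NumberTheory.EllipticCurves.Kato2004.EulerSystemValues
open Summit.BirchSwinnertonDyer.Rank1Residual.GaloisImage
open Summit.BirchSwinnertonDyer.BirchSwinnertonDyer.Theorems.KimAtThreeKolyvaginDefs
open Summit.BirchSwinnertonDyer.BirchSwinnertonDyer.Theorems.KimAtThreeTwoExponentPortOfZetaBodyU
open Summit.BirchSwinnertonDyer.BirchSwinnertonDyer.Theorems.KimAtThreeKolyvaginPortShared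
open Summit.BirchSwinnertonDyer.BirchSwinnertonDyer.Theorems.KimAtThreeShallowEqDeepOffStratumAdditiveDefectOfPort
open Summit.BirchSwinnertonDyer.BirchSwinnertonDyer.Theorems.KimAtThreeDeepUpperCertSupplyDefect
open Summit.BirchSwinnertonDyer.BirchSwinnertonDyer.Theorems.KimAtThreeDeepLowerOffStratumAdditiveDefectTorsionSplit

namespace Summit.BirchSwinnertonDyer.BirchSwinnertonDyer.Theorems.KimAtThreeOffStratumAdditiveDefectOfFineKato

/-- Local notation: the TWO-EXPONENT rider clause (ii₂) at depth `j`, torsion exponent `t`, defect exponent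
`e`, place `v`, for the pair `(Λ, Λf)` (n1011's `KatoExpStarFiniteLevelAt` clause (ii), conclusion `× 3^e`). -/
local notation3 (prettyPrint := false) "RIDER₂⟦" W' ", " j ", " t' ", " e' ", " v' ", " Λ' ", " Λf "⟧" =>
  ∀ (r : Finset (HeightOneSpectrum (𝓞 ℚ)))
    (Ψ : H1 (tateRep W' 3) (cycSubgroup 3 0 r) →+
      continuousCohomology 1
        (subgroupRep (WeierstrassCurve.torsionGaloisModule W' (((3 : ℕ) : ℤ) ^ j * ((3 : ℕ) : ℤ))).toTopRep
          (cycSubgroup 3 0 r))),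
    (∀ (φ : contOneCocycles (subgroupRep (tateRep W' 3).toTopRep (cycSubgroup 3 0 r)))
        (ψ : contOneCocycles
          (subgroupRep (WeierstrassCurve.torsionGaloisModule W' (((3 : ℕ) : ℤ) ^ j * ((3 : ℕ) : ℤ))).toTopRep
            (cycSubgroup 3 0 r))),
        (∀ g, ((ψ.1 g : geomTorsion W' (((3 : ℕ) : ℤ) ^ j * ((3 : ℕ) : ℤ))) : geomPoints W') =
          TateModule.proj 3 (j + 1) (φ.1 g)) →
        Ψ (oneCocycleClass _ φ) = oneCocycleClass _ ψ) →
    ∀ (y : H1 (tateRep W' 3) (cycSubgroup 3 0 r))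
      (κ₀ : galoisCohomology (WeierstrassCurve.torsionGaloisModule W' (((3 : ℕ) : ℤ) ^ j * ((3 : ℕ) : ℤ))) 1)
      (s : ℤ_[3]),
      resSubgroup (WeierstrassCurve.torsionGaloisModule W' (((3 : ℕ) : ℤ) ^ j * ((3 : ℕ) : ℤ))).toTopRep
          (cycSubgroup 3 0 r) 1 κ₀ = Ψ y →
      galoisCohomology.localization (WeierstrassCurve.torsionGaloisModule W' (((3 : ℕ) : ℤ) ^ j * ((3 : ℕ) : ℤ)))
          (Sum.inr v') 1 κ₀ ∈ propagatedSelmerStructure W' 3 j (Sum.inr v') →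
      (∃ l ∈ cycIntLattice 3 (cycLevel 3 0 r),
          (((3 : ℕ) : ℤ_[3]) ^ t') • Λ' 0 r y - ((s : ℚ_[3]) ⊗ₜ[ℚ] (1 : CyclotomicField (cycLevel 3 0 r) ℚ)) =
            (((3 : ℕ) : ℤ_[3]) ^ (j + 1)) • (l : ℚ_[3] ⊗[ℚ] CyclotomicField (cycLevel 3 0 r) ℚ)) →
      ((3 ^ e' : ℕ) : ZMod (3 ^ (j + 1))) *
        Λf (galoisCohomology.localization
          (WeierstrassCurve.torsionGaloisModule W' (((3 : ℕ) : ℤ) ^ j * ((3 : ℕ) : ℤ))) (Sum.inr v') 1 κ₀) =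
        PadicInt.toZModPow (j + 1) s

/-- Local notation: **(C1₂) the FINE KATO PACKAGE in two-exponent form** on the additive-defect rows. -/
local notation3 (prettyPrint := false) "FINEKATO₂" =>
  ∀ (W : WeierstrassCurve ℚ) [W.IsElliptic] [W.IsGloballyMinimal]
    [ContinuousSMul ℤ_[3] (W.tateModule 3)] [Module.Free ℤ_[3] (W.tateModule 3)]
    [Module.Finite ℤ_[3] (W.tateModule 3)],
    (∀ m : ℕ, W.HasSurjectiveModNGaloisRep (3 ^ m : ℕ)) →
    (haveI : Fact (Nat.Prime 3) := ⟨Nat.prime_three⟩; Addv W 3) →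
    Nat.card {Q : (W.baseChange ℚ_[3]).toAffine.Point // (3 : ℕ) • Q = 0} = 1 →
    ∀ (v₃ : HeightOneSpectrum (𝓞 ℚ)), ((3 : ℕ) : 𝓞 ℚ) ∈ v₃.asIdeal →
    ∀ {N : ℕ} [NeZero N] (P : ModularParametrizationData W N), N = W.conductorNorm ℤ →
      (∀ z ∈ P.L.lattice, ∃ w ∈ periodLattice P.f, z = P.c * w) →
      (3 ∣ (W.baseChange ℚ_[3]).localTamagawaNumber ℤ_[3] ∨ (3 : ℤ) ∣ P.maninConstant) →
      ∃ (ι : (n : ℕ) → (CyclotomicField n ℚ →+* ℂ)) (κK : ℝ)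
        (Λ : ∀ (k' : ℕ) (r : Finset (HeightOneSpectrum (𝓞 ℚ))),
          H1 (tateRep W 3) (cycSubgroup 3 k' r) →ₗ[ℤ_[3]]
            ℚ_[3] ⊗[ℚ] CyclotomicField (cycLevel 3 k' r) ℚ)
        (Λfin : ∀ j : ℕ, galoisCohomology
          ((W.torsionGaloisModule (((3 : ℕ) : ℤ) ^ j * ((3 : ℕ) : ℤ))).toLocal (Sum.inr v₃)) 1 →+
            ZMod (3 ^ (j + 1))) (e : ℕ),
        κK ≠ 0 ∧ (∃ u : ℚ, (u : ℝ) = κK ∧ padicValRat 3 u = 0) ∧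
        (∀ j : ℕ,
          (∀ c : ZMod (3 ^ (j + 1)), ∃ x ∈ propagatedSelmerStructure W 3 j (Sum.inr v₃), Λfin j x = c) ∧
          (∀ x ∈ propagatedSelmerStructure W 3 j (Sum.inr v₃),
            Λfin j x = 0 ↔ x ∈ W.kummerSelmerStructure (((3 : ℕ) : ℤ) ^ j * ((3 : ℕ) : ℤ)) (Sum.inr v₃))) ∧
        (∀ j : ℕ, RIDER₂⟦W, j, 0, e, v₃, Λ, Λfin j⟧) ∧
        ∀ (c d a : ℤ) (A : ℕ), 0 < A → Int.gcd c (6 * 3 * A) = 1 → Int.gcd d (6 * 3 * N) = 1 →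
          ∃ (z : ∀ (k' : ℕ) (r : (cyclotomicLevelsRat 3 (badPlaces c d A N)).Ideals),
                H1 (tateRep W 3) ((cyclotomicLevelsRat 3 (badPlaces c d A N)).level k' r.1))
            (x : ∀ (k' : ℕ) (r : (cyclotomicLevelsRat 3 (badPlaces c d A N)).Ideals),
                CyclotomicField (cycLevel 3 k' r.1) ℚ),
            ZetaBody W 3 P.f ι κK Λ c d a A z x

/-- Local notation: **(C2₂) the CERTIFICATE SUPPLY** on the additive-defect rows (kim3's (C2) verbatim on them). -/
local notation3 (prettyPrint := false) "CERTSUPPLY₂" =>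
  ∀ (W : WeierstrassCurve ℚ) [W.IsElliptic] [W.IsGloballyMinimal],
    (∀ m : ℕ, W.HasSurjectiveModNGaloisRep (3 ^ m : ℕ)) →
    (haveI : Fact (Nat.Prime 3) := ⟨Nat.prime_three⟩; Addv W 3) →
    Nat.card {Q : (W.baseChange ℚ_[3]).toAffine.Point // (3 : ℕ) • Q = 0} = 1 →
    ∀ {N : ℕ} [NeZero N] (P : ModularParametrizationData W N), N = W.conductorNorm ℤ →
      (∀ z ∈ P.L.lattice, ∃ w ∈ periodLattice P.f, z = P.c * w) →
      (3 ∣ (W.baseChange ℚ_[3]).localTamagawaNumber ℤ_[3] ∨ (3 : ℤ) ∣ P.maninConstant) →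
      ∃ (c d a : ℤ) (A : ℕ) (d' : ℤ) (aM : ℕ → ℤ),
        0 < A ∧ Int.gcd c (6 * 3 * A) = 1 ∧ Int.gcd d (6 * 3 * N) = 1 ∧
        (∀ q : ℕ, q.Prime → q ≡ 1 [MOD 3] → ¬ q ∣ 2 * c.natAbs * d.natAbs * A) ∧
        Int.gcd (c * d) A = 1 ∧ d * d' ≡ 1 [ZMOD (A : ℤ)] ∧ Nat.Coprime A N ∧
        (∀ q ∈ (3 * A).primeFactors, cuspCoeff P.f q = aM q) ∧
        (∏ q ∈ (3 * A).primeFactors,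
            (1 - (aM q : ℚ) / q + (if q ∣ N then 0 else (1 / q : ℚ))) ≠ 0) ∧
        padicValRat 3 (∏ q ∈ (3 * A).primeFactors,
            (1 - (aM q : ℚ) / q + (if q ∣ N then 0 else (1 / q : ℚ)))) = 0 ∧
        ((c : ℚ) ^ 2 * (d : ℚ) ^ 2 * ratMinusSymbol P.f ((a : ℚ) / A) -
            (c : ℚ) * (d : ℚ) ^ 2 * ratMinusSymbol P.f ((a * c : ℚ) / A) -
            (c : ℚ) ^ 2 * (d : ℚ) * ratMinusSymbol P.f ((a * d' : ℚ) / A) +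
            (c : ℚ) * (d : ℚ) * ratMinusSymbol P.f ((a * c * d' : ℚ) / A) ≠ 0) ∧
        padicValRat 3 ((c : ℚ) ^ 2 * (d : ℚ) ^ 2 * ratMinusSymbol P.f ((a : ℚ) / A) -
            (c : ℚ) * (d : ℚ) ^ 2 * ratMinusSymbol P.f ((a * c : ℚ) / A) -
            (c : ℚ) ^ 2 * (d : ℚ) * ratMinusSymbol P.f ((a * d' : ℚ) / A) +
            (c : ℚ) * (d : ℚ) * ratMinusSymbol P.f ((a * c * d' : ℚ) / A)) = 0

/-- Local notation: the `t = 0` PORT₂ binder on the additive-defect rows (acc6 gen 0's `hPort₂`, this seat's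
TorsionSplit §8 `hPort₂`), VERBATIM. -/
local notation3 (prettyPrint := false) "PORT₂ROWS⁰" =>
  ∀ (W : WeierstrassCurve ℚ) [W.IsElliptic] [W.IsGloballyMinimal],
    (∀ m : ℕ, W.HasSurjectiveModNGaloisRep (3 ^ m : ℕ)) →
    (haveI : Fact (Nat.Prime 3) := ⟨Nat.prime_three⟩; Addv W 3) →
    Nat.card {Q : (W.baseChange ℚ_[3]).toAffine.Point // (3 : ℕ) • Q = 0} = 1 →
    ∀ (v₃ : HeightOneSpectrum (𝓞 ℚ)), ((3 : ℕ) : 𝓞 ℚ) ∈ v₃.asIdeal →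
    ∀ (η : (q : HeightOneSpectrum (𝓞 ℚ)) → (ZMod (Ideal.absNorm q.asIdeal))ˣ),
      (∀ q, Subgroup.zpowers (η q) = ⊤) →
    ∀ {N : ℕ} [NeZero N] (P : ModularParametrizationData W N), N = W.conductorNorm ℤ →
      (∀ z ∈ P.L.lattice, ∃ w ∈ periodLattice P.f, z = P.c * w) →
      (3 ∣ (W.baseChange ℚ_[3]).localTamagawaNumber ℤ_[3] ∨ (3 : ℤ) ∣ P.maninConstant) →
        ∃ e : ℕ, KatoKuriharaPortThreeAtWith₂TwoExp W 0 e v₃ η P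

/-- Local notation: **(R₁) the `t ≥ 1` additive rows** — the conclusion of crux 19679 DISPLAYED on the additive
optimal tower rows of analytic rank `0` with `#E(ℚ₃)[3] ≠ 1` (binders of the registered stub verbatim, the defect
disjunction replaced by its torsion disjunct; this seat's TorsionSplit §8 `hTors`). -/
local notation3 (prettyPrint := false) "TORSROWS" =>
  ∀ (W₀ : WeierstrassCurve ℚ) [W₀.IsElliptic] [W₀.IsGloballyMinimal],
    (∀ n : ℕ, W₀.HasSurjectiveModNGaloisRep (3 ^ n : ℕ)) → Finite W₀.sha →
    ∀ {N : ℕ} [NeZero N], N = W₀.conductorNorm ℤ →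
    ∀ (D₀ : ModularParametrizationData W₀ N),
      (∀ z ∈ D₀.L.lattice, ∃ w ∈ periodLattice D₀.f, z = D₀.c * w) →
      (∀ (W₂ : WeierstrassCurve ℚ) [W₂.IsElliptic] (D₂ : ModularParametrizationData W₂ N),
        D₂.f = D₀.f → D₀.modularDegree ≤ D₂.modularDegree) →
      (∀ r : ℚ, ratPlusSymbol D₀.f r ≠ 0 → 0 ≤ padicValRat 3 (ratPlusSymbol D₀.f r)) →
      kuriharaVanishingOrder W₀ 3 D₀.f = 0 →
      (haveI : Fact (Nat.Prime 3) := ⟨Nat.prime_three⟩; Addv W₀ 3) →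
      Nat.card {Q : (W₀.baseChange ℚ_[3]).toAffine.Point // (3 : ℕ) • Q = 0} ≠ 1 →
      ∃ d : ℕ, kuriharaPartialDeepInfty W₀ 3 D₀.f = d ∧
        kuriharaPartial W₀ 3 D₀.f 0 ≤
          ((padicValNat 3 (Nat.card (AddCommGroup.primaryComponent W₀.sha 3)) + d : ℕ) : ℕ∞)

/-- Local notation: the registered `stub_additiveDefect` signature of crux 19679 (BC3 birth skeleton e575d030),
VERBATIM. -/
local notation3 (prettyPrint := false) "STUB19679" =>
  ∀ (W₀ : WeierstrassCurve ℚ) [W₀.IsElliptic] [W₀.IsGloballyMinimal],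
    (∀ n : ℕ, W₀.HasSurjectiveModNGaloisRep (3 ^ n : ℕ)) → Finite W₀.sha →
    ∀ {N : ℕ} [NeZero N], N = W₀.conductorNorm ℤ →
    ∀ (D₀ : Literature.NumberTheory.EllipticCurves.ModularForms.ModularParametrizationData W₀ N),
      (∀ z ∈ D₀.L.lattice, ∃ w ∈ Literature.NumberTheory.EllipticCurves.ModularForms.periodLattice D₀.f, z = D₀.c * w) →
      (∀ (W₂ : WeierstrassCurve ℚ) [W₂.IsElliptic]
        (D₂ : Literature.NumberTheory.EllipticCurves.ModularForms.ModularParametrizationData W₂ N),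
        D₂.f = D₀.f → D₀.modularDegree ≤ D₂.modularDegree) →
      (∀ r : ℚ, Literature.NumberTheory.EllipticCurves.ratPlusSymbol D₀.f r ≠ 0 →
        0 ≤ padicValRat 3 (Literature.NumberTheory.EllipticCurves.ratPlusSymbol D₀.f r)) →
      Literature.NumberTheory.EllipticCurves.kuriharaVanishingOrder W₀ 3 D₀.f = 0 →
      (haveI : Fact (Nat.Prime 3) := ⟨Nat.prime_three⟩;
          Literature.NumberTheory.EllipticCurves.Rank1Residual.Addv W₀ 3) →
      (3 ∣ (W₀.baseChange ℚ_[3]).localTamagawaNumber ℤ_[3] ∨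
        Nat.card {Q : (W₀.baseChange ℚ_[3]).toAffine.Point // (3 : ℕ) • Q = 0} ≠ 1 ∨
        (3 : ℤ) ∣ D₀.maninConstant) →
      ∃ d : ℕ, Literature.NumberTheory.EllipticCurves.kuriharaPartialDeepInfty W₀ 3 D₀.f = d ∧
        Literature.NumberTheory.EllipticCurves.kuriharaPartial W₀ 3 D₀.f 0 ≤
          ((padicValNat 3 (Nat.card (AddCommGroup.primaryComponent W₀.sha 3)) + d : ℕ) : ℕ∞)

/-- Local notation: the registered `stub_additiveDefect` signature of crux 19599 (BC3 birth skeleton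
`ShallowEqDeepOffKatoStratum_birth.lean`), VERBATIM (as concluded by acc6's ★s). -/
local notation3 (prettyPrint := false) "STUB19599" =>
  ∀ (W₀ : WeierstrassCurve ℚ) [W₀.IsElliptic] [W₀.IsGloballyMinimal],
    (∀ n : ℕ, W₀.HasSurjectiveModNGaloisRep (3 ^ n : ℕ)) →
    Nat.card {Q : (W₀.baseChange ℚ_[3]).toAffine.Point // (3 : ℕ) • Q = 0} = 1 → Finite W₀.sha →
    ∀ {N : ℕ} [NeZero N], N = W₀.conductorNorm ℤ →
    ∀ (D₀ : Literature.NumberTheory.EllipticCurves.ModularForms.ModularParametrizationData W₀ N),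
      (∀ z ∈ D₀.L.lattice, ∃ w ∈ Literature.NumberTheory.EllipticCurves.ModularForms.periodLattice D₀.f, z = D₀.c * w) →
      (∀ (W₂ : WeierstrassCurve ℚ) [W₂.IsElliptic]
        (D₂ : Literature.NumberTheory.EllipticCurves.ModularForms.ModularParametrizationData W₂ N),
        D₂.f = D₀.f → D₀.modularDegree ≤ D₂.modularDegree) →
      (∀ r : ℚ, Literature.NumberTheory.EllipticCurves.ratPlusSymbol D₀.f r ≠ 0 →
        0 ≤ padicValRat 3 (Literature.NumberTheory.EllipticCurves.ratPlusSymbol D₀.f r)) →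
      Literature.NumberTheory.EllipticCurves.kuriharaVanishingOrder W₀ 3 D₀.f = 0 →
      (haveI : Fact (Nat.Prime 3) := ⟨Nat.prime_three⟩;
          Literature.NumberTheory.EllipticCurves.Rank1Residual.Addv W₀ 3) →
      (3 ∣ (W₀.baseChange ℚ_[3]).localTamagawaNumber ℤ_[3] ∨ (3 : ℤ) ∣ D₀.maninConstant) →
      Literature.NumberTheory.EllipticCurves.kuriharaPartialDeepInfty W₀ 3 D₀.f ≤
        Literature.NumberTheory.EllipticCurves.kuriharaPartialInfty W₀ 3 D₀.f

/-! ### §1 PORT₂ at one `t = 0` additive-defect row from (C1₂) + (C2₂) — anomalous bad places ALLOWED -/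

/-- **PORT₂ at a `t = 0` additive-defect row from the FINE KATO PACKAGE (C1₂) and the CERTIFICATE SUPPLY (C2₂), with
NO `hbad`** — the defect-row binders (tower, `Addv W 3`, `#E(ℚ₃)[3] = 1`, `v₃ ∣ 3`, any `η`, `P` lattice-optimal at
`N = N_W`, `3 ∣ c₃ ∨ 3 ∣ c_P`) give `∃ e, KatoKuriharaPortThreeAtWith₂TwoExp W 0 e v₃ η P` by ★₂′-u with `ht0`,
`9 ∣ N`, `Irr(E[3])` and the Tate-module instance binders discharged (kim3 §1 lemmas by name).  Seat acc6's
`portTwoExp_row_of_fineKato_of_certSupply_of_noAnomalous` with the binder `hbad` DELETED.  (C1₂)/(C2₂) displayed;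
nothing booked.
[cite: Kato2004Asterisque, (8.1.3) (p. 180), Prop. 8.12 (p. 186), §9.4 and Thm. 9.7 (pp. 188–189), Thm. 6.6 (1) (p. 163), Ex. 13.3 (pp. 224–225)]
[cite: Kim2022StructureSelmer, Thm. 3.13, §3.2.3 and §3.3–§3.4.1] [cite: MazurRubin2004, Thm. 3.2.4 and App. A (Remark A.5)]
[cite: Kim2025RefinedTNC, §4.2 and §8.1.2] -/
theorem portTwoExp_row_of_fineKato_of_certSupply
    (hC1 : FINEKATO₂) (hC2 : CERTSUPPLY₂)
    (W : WeierstrassCurve ℚ) [W.IsElliptic] [W.IsGloballyMinimal]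
    (htow : ∀ m : ℕ, W.HasSurjectiveModNGaloisRep (3 ^ m : ℕ))
    (hadd : haveI : Fact (Nat.Prime 3) := ⟨Nat.prime_three⟩; Addv W 3)
    (ht : Nat.card {Q : (W.baseChange ℚ_[3]).toAffine.Point // (3 : ℕ) • Q = 0} = 1)
    (v₃ : HeightOneSpectrum (𝓞 ℚ)) (hv₃ : ((3 : ℕ) : 𝓞 ℚ) ∈ v₃.asIdeal)
    (η : (q : HeightOneSpectrum (𝓞 ℚ)) → (ZMod (Ideal.absNorm q.asIdeal))ˣ)
    {N : ℕ} [NeZero N] (P : ModularParametrizationData W N) (hN : N = W.conductorNorm ℤ)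
    (hlat : ∀ z ∈ P.L.lattice, ∃ w ∈ periodLattice P.f, z = P.c * w)
    (hdef : 3 ∣ (W.baseChange ℚ_[3]).localTamagawaNumber ℤ_[3] ∨ (3 : ℤ) ∣ P.maninConstant) :
    ∃ e : ℕ, KatoKuriharaPortThreeAtWith₂TwoExp W 0 e v₃ η P := by
  haveI : Fact (Nat.Prime 3) := ⟨Nat.prime_three⟩
  haveI : ContinuousSMul ℤ_[3] (W.tateModule 3) := TateModule.continuousSMul_padicInt
  haveI : Module.Free ℤ_[3] (W.tateModule 3) := W.module_free_tateModule_holds 3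
  haveI : Module.Finite ℤ_[3] (W.tateModule 3) := W.module_finite_tateModule_holds 3
  obtain ⟨c, d, a, A, d', aM, hA, hcA, hdN, hcdA, hcd, hdd', hAN, haM, hE0, hE, hR0, hR⟩ :=
    hC2 W htow hadd ht P hN hlat hdef
  haveI : NeZero A := ⟨hA.ne'⟩
  obtain ⟨ι, κK, Λ, Λfin, e, hκ0, hNorm, hΛ, hfin₂, hz⟩ := hC1 W htow hadd ht v₃ hv₃ P hN hlat hdef
  obtain ⟨z, x, hbody⟩ := hz c d a A hA hcA hdN
  have hirr : W.HasIrreducibleModPGaloisRep 3 := hasIrreducibleModPGaloisRep_three_of_tower W htow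
  have hpN : 3 ^ 2 ∣ N := hN ▸ sq_dvd_conductorNorm_of_addv W hadd
  have ht0 : ∀ w : HeightOneSpectrum (𝓞 ℚ), ((3 : ℕ) : 𝓞 ℚ) ∈ w.asIdeal →
      ∀ Q : (W.baseChange (w.adicCompletion ℚ)).toAffine.Point, 3 • Q = 0 → Q = 0 :=
    fun w hw => forall_torsion_three_eq_zero_adicCompletion_of_natCard_eq_one W ht w hw
  exact ⟨e, katoKuriharaPortThreeAtWith₂TwoExp_zero_of_zetaBody_of_unramified_of_valueRows W P hN hbody Λfin hΛ
    hfin₂ hcdA ht0 hirr hNorm hκ0 d' hcd hdd' hAN hpN aM haM hE0 hE hR0 hR⟩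

/-! ### §2 The `t = 0` port binder `hPort₂⁰` from (C1₂) + (C2₂) — no anomalous case split -/

/-- **`hPort₂⁰` (PORT₂ on EVERY `t = 0` additive-defect row) from (C1₂) + (C2₂)** — acc6's
`portTwoExp_rows_of_fineKato_of_certSupply_of_anomalousRows` WITHOUT its third input (C3₂): no case split on the
existence of a `3`-anomalous bad place is needed once `hbad` is gone. [cite: Kato2004Asterisque, §9.4 and Thm. 9.7 (pp. 188–189)]
[cite: Kim2022StructureSelmer, Thm. 3.13 and §3.2.3] [cite: MazurRubin2004, App. A Remark A.5] -/
theorem portTwoExp_rows_of_fineKato_of_certSupply (hC1 : FINEKATO₂) (hC2 : CERTSUPPLY₂) : PORT₂ROWS⁰ :=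
  fun W _ _ htow hadd ht v₃ hv₃ η _ _ _ P hN hlat hdef =>
    portTwoExp_row_of_fineKato_of_certSupply hC1 hC2 W htow hadd ht v₃ hv₃ η P hN hlat hdef

/-! ### §3 `hPort₂⁰` from (C1₂) ALONE — (C2₂) is w2-c3's theorem -/

/-- **`hPort₂⁰` from the fine Kato package (C1₂) ALONE**: the certificate supply (C2₂) is seat w2-c3's theorem
`KimAtThreeDeepUpperCertSupplyDefect.certSupply_defectRows` (class-wide unit minus symbol + Kato's auxiliary cusp
datum at `9 ∣ N`; no `c₃` / `E(ℚ₃)[3]` / Manin hypothesis). [cite: Kato2004Asterisque, Ex. 13.3 (pp. 224–225) and Thm. 6.6 (1) (p. 163)]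
[cite: TateGCFT1967, §2.4] [cite: Kim2022StructureSelmer, Thm. 3.13] -/
theorem portTwoExp_rows_of_fineKato (hC1 : FINEKATO₂) : PORT₂ROWS⁰ :=
  portTwoExp_rows_of_fineKato_of_certSupply hC1 certSupply_defectRows

/-! ### §4 The registered stubs of cruxes 19679 and 19599 from (C1₂) (+ (R₁) for 19679) + PUB -/

/-- **`stub_additiveDefect` of crux 19679 (`DeepLowerAtThreeOffKatoStratum`), TYPE VERBATIM, ⟸ [S24] (1)(2), GZK,
Poitou–Tate BY NAME + the fine Kato package (C1₂) (displayed, construction-shaped) + the one displayed line (R₁) on the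
`t ≥ 1` additive rows** — this seat's TorsionSplit §8 fed by §3.  No (C2₂) (theorem), no (C3₂) (removed).  Composition
with the skeleton's `DeepLowerAtThreeOffKatoStratum_of` is by `exact` on this type.  Crux 19679 stays OPEN.
[cite: Kim2025RefinedTNC, Thm 1.1 and §8.1.2] [cite: Kim2022StructureSelmer, Thm. 1.9 (6), Thm. 3.13]
[cite: Sakamoto2024, Thm. 4.4 (1)(2) (p. 926)] [cite: MazurRubin2004, Thm. 5.2.12] [cite: Kato2004Asterisque, §9.4 and Thm. 9.7 (pp. 188–189)] -/
theorem stub19679_additiveDefect_of_fineKato_of_torsionRows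
    (hS24 : Sakamoto2024.kolyvaginSystems_freeRankOne_zmod_three_pow)
    (hS24₂ : Sakamoto2024.kolyvaginSystems_idealOfBasis_eq_fittingIdeal_zmod_three_pow)
    (hGZK : rank_eq_analyticRank_of_analyticRank_le_one)
    (hPT : poitouTate_selmerStructure_duality ℚ)
    (hC1 : FINEKATO₂) (hTors : TORSROWS) : STUB19679 :=
  stubAdditiveDefect_of_portTwoExp_torsionFree_of_torsionRows hS24 hS24₂ hGZK hPT (portTwoExp_rows_of_fineKato hC1)
    hTors

/-- **`stub_additiveDefect` of crux 19599 (`ShallowEqDeepOffKatoStratum`), TYPE VERBATIM, ⟸ [S24] (1)(2), GZK,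
Poitou–Tate BY NAME + the fine Kato package (C1₂) ALONE** — seat acc6 gen 0's `stub_additiveDefect_of_portTwoExp`
(`KimAtThreeShallowEqDeepOffStratumAdditiveDefectOfPort`) fed by §3; acc6 gen 2's
`stub_additiveDefect_of_fineKato_of_certSupply_of_anomalousRows` without its (C2₂)/(C3₂) inputs.  Crux 19599 stays
OPEN; its OWNER assembles. [cite: Kim2025RefinedTNC, Thm 1.1, Thm 1.2 and §8.1.2] [cite: Kim2022StructureSelmer, Thm. 1.9 (6), Thm. 3.13]
[cite: Sakamoto2024, Thm. 4.4 (p. 926)] [cite: MazurRubin2004, Thm. 5.2.12] [cite: MilneADT2006, Ch. I, Thm. 4.10] -/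
theorem stub19599_additiveDefect_of_fineKato
    (hS24 : Sakamoto2024.kolyvaginSystems_freeRankOne_zmod_three_pow)
    (hS24₂ : Sakamoto2024.kolyvaginSystems_idealOfBasis_eq_fittingIdeal_zmod_three_pow)
    (hGZK : rank_eq_analyticRank_of_analyticRank_le_one)
    (hPT : poitouTate_selmerStructure_duality ℚ)
    (hC1 : FINEKATO₂) : STUB19599 :=
  stub_additiveDefect_of_portTwoExp hS24 hS24₂ hGZK hPT (portTwoExp_rows_of_fineKato hC1)

end Summit.BirchSwinnertonDyer.BirchSwinnertonDyer.Theorems.KimAtThreeOffStratumAdditiveDefectOfFineKato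

end
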